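import Mathlib
import Summits.Ventures.PercRepro.TriangleCapOneTriangleNineB
import Summits.Ventures.PercRepro.TriangleCapThreeTrianglesG

/-!
# PercRepro — THE CELL `(9, 16)`: THE THREE-TRIANGLE CASE AND THE ASSEMBLY (p3, gen 37; part 71)

On `9` vertices three vertex-disjoint triangles fill the graph (`Sᶜ = ∅`), so `Q = 2m` and the far count reads
`Σ deficit ≥ 180 − 8m ≥ 42 = 4k + 6` for `m ≤ 17` (**`three_triangles_stability_two_of_disjoint_nine`**); the other
configurations are covered by their general theorems (`k ≥ 9`, the windmill in the dense corner), a fourth triangle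
by the envelope (`k ≥ 9`).  With the one-triangle case — an outer vertex (TriangleCapOneTriangleNineA) or none
(TriangleCapOneTriangleNineB) — and the two-triangle case (`k ≥ 8`):

* **`dense_stability_two_nine_sixteen`** — `K₄⁻`-free on `9` vertices with `16` edges, not bipartite spanning
  with at most one missing cross pair ⇒ `Σ_v d(v)² + 12 ≤ 144`.
Axioms: standard.
-/

namespace PercRepro

namespace TriangleCap

namespace C047

open Finset

variable {V : Type*} [Fintype V] [DecidableEq V]

/-- **THREE VERTEX-DISJOINT TRIANGLES ON NINE VERTICES, `m ≤ 17`.** -/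
theorem three_triangles_stability_two_of_disjoint_nine (D : SimpleGraph V) [DecidableRel D.Adj] (hK : K4mFree D)
    (hk : Fintype.card V = 9) (hm : D.edgeFinset.card ≤ 17) (T₁ T₂ T₃ : Finset V)
    (h₁ : T₁.card = 3) (h₂ : T₂.card = 3) (h₃ : T₃.card = 3)
    (h12 : Disjoint T₁ T₂) (h13 : Disjoint T₁ T₃) (h23 : Disjoint T₂ T₃)
    (hcl₁ : ∀ x ∈ T₁, ∀ y ∈ T₁, x ≠ y → D.Adj x y) (hcl₂ : ∀ x ∈ T₂, ∀ y ∈ T₂, x ≠ y → D.Adj x y)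
    (hcl₃ : ∀ x ∈ T₃, ∀ y ∈ T₃, x ≠ y → D.Adj x y)
    (hT : ∀ x y z, D.Adj x y → D.Adj x z → D.Adj y z →
      (x ∈ T₁ ∧ y ∈ T₁) ∨ (x ∈ T₂ ∧ y ∈ T₂) ∨ (x ∈ T₃ ∧ y ∈ T₃)) :
    ∑ v, deg D v * deg D v + 2 * (Fintype.card V - 3) ≤ D.edgeFinset.card * Fintype.card V := by
  have hi12 : (T₁ ∩ T₂).card ≤ 1 := by rw [disjoint_iff_inter_eq_empty.mp h12, card_empty]; exact Nat.zero_le _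
  have hi13 : (T₁ ∩ T₃).card ≤ 1 := by rw [disjoint_iff_inter_eq_empty.mp h13, card_empty]; exact Nat.zero_le _
  have hi23 : (T₂ ∩ T₃).card ≤ 1 := by rw [disjoint_iff_inter_eq_empty.mp h23, card_empty]; exact Nat.zero_le _
  have hcount := three_triangles_far_count D T₁ T₂ T₃ h₁ h₂ h₃ hi12 hi13 hi23 hcl₁ hcl₂ hcl₃
  set S := T₁ ∪ T₂ ∪ T₃ with hS
  have hd12 : Disjoint (T₁ ∪ T₂) T₃ := disjoint_union_left.mpr ⟨h13, h23⟩
  have hScard : S.card = 9 := by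
    rw [hS, card_union_of_disjoint hd12, card_union_of_disjoint h12, h₁, h₂, h₃]
  have hRempty : Sᶜ = ∅ := by
    rw [← card_eq_zero, card_compl, hScard, hk]
  have hQ : adjPairs D S = ∑ x ∈ T₁, degIn D S x + ∑ x ∈ T₂, degIn D S x + ∑ x ∈ T₃, degIn D S x := by
    rw [adjPairs_eq_sum_degIn, hS, sum_union hd12, sum_union h12]
  have hdens := two_mul_card_edges_eq_adjPairs_add D S
  simp only [hRempty, sum_empty, card_empty, mul_zero, zero_mul, add_zero, zero_add] at hdens hcount
  rw [hScard] at hcount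
  have h18 := card_triangles3_le_eighteen_of_three D T₁ T₂ T₃ h₁ h₂ h₃ hcl₁ hcl₂ hcl₃ hT
    (fun x y z z' hxy hxz hyz hxz' hyz' => eq_of_common_nbr D hK hxy hxz hyz hxz' hyz')
  have hid := two_mul_sum_deg_sq_add_sum_deficit D
  have hmk : 2 * (D.edgeFinset.card * Fintype.card V) = 2 * D.edgeFinset.card * Fintype.card V := by ring
  rw [hk] at hid hmk ⊢
  omega

/-- **THE THREE-TRIANGLE CASE AT `(9, 16)`.** -/
theorem three_triangles_stability_two_nine_sixteen (D : SimpleGraph V) [DecidableRel D.Adj] (hK : K4mFree D)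
    (hk : Fintype.card V = 9) (hm : D.edgeFinset.card = 16) {u v w a b c x y z : V}
    (huv : D.Adj u v) (huw : D.Adj u w) (hvw : D.Adj v w) (hab : D.Adj a b) (hac : D.Adj a c) (hbc : D.Adj b c)
    (hxy : D.Adj x y) (hxz : D.Adj x z) (hyz : D.Adj y z)
    (ha : ¬ (a = u ∨ a = v ∨ a = w)) (hx : ¬ (x = u ∨ x = v ∨ x = w ∨ x = a ∨ x = b ∨ x = c)) :
    ∑ v, deg D v * deg D v + 2 * (Fintype.card V - 3) ≤ D.edgeFinset.card * Fintype.card V := by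
  have hk9 : 9 ≤ Fintype.card V := by omega
  have hm' : 2 * Fintype.card V ≤ D.edgeFinset.card + 3 := by omega
  set T₁ : Finset V := {u, v, w} with hT₁
  set T₂ : Finset V := {a, b, c} with hT₂
  set T₃ : Finset V := {x, y, z} with hT₃
  have h₁ : T₁.card = 3 := card_triple huv.ne huw.ne hvw.ne
  have h₂ : T₂.card = 3 := card_triple hab.ne hac.ne hbc.ne
  have h₃ : T₃.card = 3 := card_triple hxy.ne hxz.ne hyz.ne
  have hcl₁ := clique_triple D huv huw hvw
  have hcl₂ := clique_triple D hab hac hbc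
  have hcl₃ := clique_triple D hxy hxz hyz
  have hone₁ : ∀ z', z' ∉ T₁ → degIn D T₁ z' ≤ 1 := fun z' hz => degIn_le_one_of_triangle D hK huv huw hvw hz
  have hone₂ : ∀ z', z' ∉ T₂ → degIn D T₂ z' ≤ 1 := fun z' hz => degIn_le_one_of_triangle D hK hab hac hbc hz
  have hone₃ : ∀ z', z' ∉ T₃ → degIn D T₃ z' ≤ 1 := fun z' hz => degIn_le_one_of_triangle D hK hxy hxz hyz hz
  have hx1 : ¬ (x = u ∨ x = v ∨ x = w) := fun h => hx (by tauto)
  have hx2 : ¬ (x = a ∨ x = b ∨ x = c) := fun h => hx (by tauto)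
  have hi12 : (T₁ ∩ T₂).card ≤ 1 := inter_card_le_one_of_triangles D hK huv huw hvw hab hac hbc ha
  have hi13 : (T₁ ∩ T₃).card ≤ 1 := inter_card_le_one_of_triangles D hK huv huw hvw hxy hxz hyz hx1
  have hi23 : (T₂ ∩ T₃).card ≤ 1 := inter_card_le_one_of_triangles D hK hab hac hbc hxy hxz hyz hx2
  by_cases hT : ∀ x' y' z', D.Adj x' y' → D.Adj x' z' → D.Adj y' z' →
      (x' ∈ T₁ ∧ y' ∈ T₁) ∨ (x' ∈ T₂ ∧ y' ∈ T₂) ∨ (x' ∈ T₃ ∧ y' ∈ T₃)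
  · rcases eq_empty_or_singleton_of_card_le_one hi12 with e12 | ⟨t, e12⟩ <;>
      rcases eq_empty_or_singleton_of_card_le_one hi13 with e13 | ⟨t', e13⟩ <;>
      rcases eq_empty_or_singleton_of_card_le_one hi23 with e23 | ⟨t'', e23⟩
    · exact three_triangles_stability_two_of_disjoint_nine D hK hk (by omega) T₁ T₂ T₃ h₁ h₂ h₃
        (disjoint_iff_inter_eq_empty.mpr e12) (disjoint_iff_inter_eq_empty.mpr e13)
        (disjoint_iff_inter_eq_empty.mpr e23) hcl₁ hcl₂ hcl₃ hT
    · exact three_triangles_stability_two_of_one_shared D hK hk9 T₂ T₃ T₁ h₂ h₃ h₁ e23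
        (disjoint_iff_inter_eq_empty.mpr (by rw [inter_comm]; exact e12))
        (disjoint_iff_inter_eq_empty.mpr (by rw [inter_comm]; exact e13)) hcl₂ hcl₃ hcl₁ hone₂ hone₃ hone₁
        (fun x' y' z' h1 h2 h3 => by
          rcases hT x' y' z' h1 h2 h3 with h | h | h
          · exact Or.inr (Or.inr h)
          · exact Or.inl h
          · exact Or.inr (Or.inl h))
    · exact three_triangles_stability_two_of_one_shared D hK hk9 T₁ T₃ T₂ h₁ h₃ h₂ e13
        (disjoint_iff_inter_eq_empty.mpr e12)
        (disjoint_iff_inter_eq_empty.mpr (by rw [inter_comm]; exact e23)) hcl₁ hcl₃ hcl₂ hone₁ hone₃ hone₂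
        (fun x' y' z' h1 h2 h3 => by
          rcases hT x' y' z' h1 h2 h3 with h | h | h
          · exact Or.inl h
          · exact Or.inr (Or.inr h)
          · exact Or.inr (Or.inl h))
    · exact three_triangles_stability_two_of_path D hK hk9 T₁ T₃ T₂ h₁ h₃ h₂ e13
        (by rw [inter_comm]; exact e23) (disjoint_iff_inter_eq_empty.mpr e12) hcl₁ hcl₃ hcl₂ hone₁ hone₃ hone₂
        (fun x' y' z' h1 h2 h3 => by
          rcases hT x' y' z' h1 h2 h3 with h | h | h
          · exact Or.inl h
          · exact Or.inr (Or.inr h)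
          · exact Or.inr (Or.inl h))
    · exact three_triangles_stability_two_of_one_shared D hK hk9 T₁ T₂ T₃ h₁ h₂ h₃ e12
        (disjoint_iff_inter_eq_empty.mpr e13) (disjoint_iff_inter_eq_empty.mpr e23) hcl₁ hcl₂ hcl₃
        hone₁ hone₂ hone₃ hT
    · exact three_triangles_stability_two_of_path D hK hk9 T₁ T₂ T₃ h₁ h₂ h₃ e12 e23
        (disjoint_iff_inter_eq_empty.mpr e13) hcl₁ hcl₂ hcl₃ hone₁ hone₂ hone₃ hT
    · exact three_triangles_stability_two_of_path D hK hk9 T₂ T₁ T₃ h₂ h₁ h₃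
        (by rw [inter_comm]; exact e12) e13 (disjoint_iff_inter_eq_empty.mpr e23) hcl₂ hcl₁ hcl₃
        hone₂ hone₁ hone₃
        (fun x' y' z' h1 h2 h3 => by
          rcases hT x' y' z' h1 h2 h3 with h | h | h
          · exact Or.inr (Or.inl h)
          · exact Or.inl h
          · exact Or.inr (Or.inr h))
    · obtain ⟨htt', htt''⟩ := shared_eq_of_three D hK h₁ hcl₁ hcl₂ hcl₃ e12 e13 e23
      subst htt'
      subst htt''
      exact three_triangles_stability_two_of_windmill D hK (by omega) hm' T₁ T₂ T₃ h₁ h₂ h₃ e12 e13 e23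
        hcl₁ hcl₂ hcl₃ hone₁ hone₂ hone₃ hT
  · simp only [not_forall, not_or] at hT
    obtain ⟨x', y', z', hxy', hxz', hyz', h1, h2, h3⟩ := hT
    set T₄ : Finset V := {x', y', z'} with hT₄
    have hx'4 : x' ∈ T₄ := by rw [hT₄]; exact mem_insert_self _ _
    have hy'4 : y' ∈ T₄ := by rw [hT₄]; exact mem_insert_of_mem (mem_insert_self _ _)
    have hne1 : T₄ ≠ T₁ := fun h => h1 ⟨h ▸ hx'4, h ▸ hy'4⟩
    have hne2 : T₄ ≠ T₂ := fun h => h2 ⟨h ▸ hx'4, h ▸ hy'4⟩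
    have hne3 : T₄ ≠ T₃ := fun h => h3 ⟨h ▸ hx'4, h ▸ hy'4⟩
    have hne12 : T₁ ≠ T₂ := fun h => by rw [h, inter_self, h₂] at hi12; omega
    have hne13 : T₁ ≠ T₃ := fun h => by rw [h, inter_self, h₃] at hi13; omega
    have hne23 : T₂ ≠ T₃ := fun h => by rw [h, inter_self, h₃] at hi23; omega
    have hF : ({T₁, T₂, T₃, T₄} : Finset (Finset V)).card = 4 := by
      rw [card_insert_of_notMem, card_insert_of_notMem, card_insert_of_notMem, card_singleton]
      · rw [mem_singleton]; exact Ne.symm hne3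
      · rw [mem_insert, mem_singleton, not_or]; exact ⟨hne23, Ne.symm hne2⟩
      · rw [mem_insert, mem_insert, mem_singleton, not_or, not_or]; exact ⟨hne12, hne13, Ne.symm hne1⟩
    have h24 := six_mul_card_le_card_triangles3 D {T₁, T₂, T₃, T₄} (by
      intro T hT
      simp only [mem_insert, mem_singleton] at hT
      rcases hT with rfl | rfl | rfl | rfl
      · exact ⟨u, v, w, huv, huw, hvw, rfl⟩
      · exact ⟨a, b, c, hab, hac, hbc, rfl⟩
      · exact ⟨x, y, z, hxy, hxz, hyz, rfl⟩
      · exact ⟨x', y', z', hxy', hxz', hyz', rfl⟩)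
    rw [hF] at h24
    exact stability_two_of_twentyfour D hK hk9 h24

/-- **THE CELL `(9, 16)`: THE DENSE-CORNER STABILITY WITH GAP `12`** for `K₄⁻`-free graphs on `9` vertices with `16`
edges that are not bipartite spanning with at most one missing cross pair. -/
theorem dense_stability_two_nine_sixteen (D : SimpleGraph V) [DecidableRel D.Adj] (hK : K4mFree D)
    (hk : Fintype.card V = 9) (hm : D.edgeFinset.card = 16)
    (hnot : ¬ ∃ A : Finset V, (∀ x y, D.Adj x y → (x ∈ A ↔ y ∉ A)) ∧ (missing D A Aᶜ).card ≤ 1) :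
    ∑ v, deg D v * deg D v + 2 * (Fintype.card V - 3) ≤ D.edgeFinset.card * Fintype.card V := by
  have hm' : 2 * Fintype.card V ≤ D.edgeFinset.card + 3 := by omega
  by_cases hfree : D.CliqueFree 3
  · exact triangle_free_stability_two D hfree hm' hnot
  · obtain ⟨S, hS⟩ := not_forall.mp hfree
    have hS' := not_not.mp hS
    rw [SimpleGraph.is3Clique_iff] at hS'
    obtain ⟨u, v, w, huv, huw, hvw, -⟩ := hS'
    by_cases hT : ∀ a b c, D.Adj a b → D.Adj a c → D.Adj b c → a = u ∨ a = v ∨ a = w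
    · by_cases hout : ∃ z, z ∉ ({u, v, w} : Finset V) ∧ degIn D {u, v, w} z = 0
      · exact one_triangle_stability_two_of_outer D hK huv huw hvw hT hm' hout
      · apply one_triangle_nine_sixteen_no_outer D hK hk hm huv huw hvw hT
        intro z hz
        by_contra h0
        exact hout ⟨z, hz, by omega⟩
    · simp only [not_forall, not_or] at hT
      obtain ⟨a, b, c, hab, hac, hbc, hau, hav, haw⟩ := hT
      have ha : ¬ (a = u ∨ a = v ∨ a = w) := fun h => by
        rcases h with h | h | h
        · exact hau h
        · exact hav h
        · exact haw h
      by_cases hT3 : ∀ x y z, D.Adj x y → D.Adj x z → D.Adj y z →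
          x = u ∨ x = v ∨ x = w ∨ x = a ∨ x = b ∨ x = c
      · exact two_triangles_stability_two_of_eight D hK (by omega) hm' huv huw hvw hab hac hbc ha hT3
      · simp only [not_forall, not_or] at hT3
        obtain ⟨x, y, z, hxy, hxz, hyz, hxu, hxv, hxw, hxa, hxb, hxc⟩ := hT3
        exact three_triangles_stability_two_nine_sixteen D hK hk hm huv huw hvw hab hac hbc hxy hxz hyz ha
          (fun h => by
            rcases h with h | h | h | h | h | h
            · exact hxu h
            · exact hxv h
            · exact hxw h
            · exact hxa h
            · exact hxb h
            · exact hxc h)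

end C047

end TriangleCap

end PercRepro
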